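import Summits.BirchSwinnertonDyer.BirchSwinnertonDyer.Theorems.PrintCf2SplitBadTwoCMPrimaryLocalPinning
import Summits.BirchSwinnertonDyer.BirchSwinnertonDyer.Theorems.PrintCf2SplitBadTwoCMShaConjugationSwap
import Literature.NumberTheory.EllipticCurves.HeegnerPointsKolyvaginProp81InertiaProofs
import Literature.NumberTheory.GaloisRepresentations.IntegralGaloisActionProofs
import Literature.NumberTheory.GaloisRepresentations.RamificationFiltrationProofs
import Literature.NumberTheory.EllipticCurves.SemilinearTateDual
import HarnessLib

/-!
# Crux `PrintCf2.SplitBadTwoRankOneOfFacts` (item stmt-BirchSwinnertonDyer-20368), road α over the CM field: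
# TRANSPORT OF THE CM SUMMANDS AND OF INERTIA GROUPS ABOVE `2` ALONG A LIFT OF COMPLEX CONJUGATION

Cell `bsd-print-cf2`, width seat `bsd-line-cf2-p1-w2` g8; `--supports stmt-BirchSwinnertonDyer-20368` (helper). HONEST FRAMING: nothing
here closes a crux or a stub; BSD is not proved by any of this; no summit statement is proved by this seat. THEOREMS ONLY (no
definition, no named fact, no `sorry`). FILE 3 of the -w2 g8 pinning series (FILE 1 `…CMPrimaryLocalTypesOfDatum`, FILE 2
`…CMPrimaryLocalPinning`); the engine of FILE 4 `…CMPrimaryPinningSwap` (the `v ↔ v̄` swap of the pinning clause).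

WHAT. `W/ℚ` elliptic, `K` a number field, `π ∈ End_K(E_K)` with `π² = π − 2`, `E[𝔮_ρ^∞] := (W.baseChange K).endEigenPrimaryTorsion 2 π ρ`
(p646843). The complex-conjugation symmetry of the CM theory — `c(E[𝔭^∞]) = E[𝔭̄^∞]` — in the kernel's currency, with `c` replaced by
a ring automorphism `τ` of `K̄` that ANTI-commutes with `π`:
* §1 `exists_transport_anticommute` — for `K/ℚ` normal there is `σ₀ ∈ Γ_ℚ` whose transport `τ = e σ₀ e⁻¹` to `K̄` (the tree's
  `absGaloisTransportRat K σ₀`, a lift of `τ|_K ∈ Aut(K/ℚ)`, `IsLiftOfAut`) satisfies `π(τQ) = τQ − τ(πQ)` on `E(K̄)` (from -w8 g0's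
  `exists_ratConj_of_cmIsogeny` on the isogeny realising `π`, `exists_isogeny_apply_eq_cmEndo`); `pointsMap_pointsMap_symm`,
  `pointsMap_symm_pointsMap`, `pointsMap_symm_anticommute` (the inverse lift anti-commutes too);
* §2 `exists_conjGalCMH_mem_inertia_of_transport` — **`τ⁻¹ I_𝔔 τ ≤ I_{𝔔'}` with `𝔔' ∋ 2`**: for a prime `𝔔 ∋ 2` of `\bar ℤ_K` and
  `σ ∈ I_𝔔`, the conjugate `τ⁻¹στ` (`IsLiftOfAut.conjGalCMH`) lies in the inertia group of the prime `𝔔' = T⁻¹𝔔 ∋ 2`, `T` the transport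
  on `\bar ℤ_K` (the tree's `InertiaLift` bookkeeping, written there for `σ₀` stabilising `𝔔`; here for any `σ₀`);
* §3 the pointwise clause «an inertia group acts on `E[𝔮_ρ^∞]` as `±1`»: `smul_eq_or_neg_of_conj` (conjugation invariance),
  **`forall_prime_inertia_smul_eq_or_neg`** (clause for `GreenbergSelmer.inertia w` at every place `w ∋ 2` ⟹ clause for `I_𝔔` at every prime
  `𝔔 ∋ 2` of `\bar ℤ_K`: transitivity `exists_smul_eq_of_mem_primesAbove_holds`, `Ideal.inertia_smul`, `inertia_adicCompletionPrime_eq_map_absInertia`),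
  `eq_or_eq_of_two_mem` (quadratic `K`, `2 = v v̄`: every place above `2` is `v` or `v̄`), `mem_endEigenPrimaryTorsion_one_sub_of_anticommute`
  (an anti-commuting additive bijection maps `E[𝔮_ρ^∞]` into `E[𝔮_{1−ρ}^∞]`), and **`forall_prime_inertia_smul_eq_or_neg_of_transport`**:
  the all-primes clause passes from `E[𝔮_ρ^∞]` to `E[𝔮_{1−ρ}^∞]` along `τ` (`g·(τy) = τ((τ⁻¹gτ)·y)`, `IsLiftOfAut.pointsMap_smul`).

References: K. Rubin, LNM 1716 (1999) §3 (Lemma 3.6 (ii), Cor. 3.17); B. H. Gross, LMS LNS 153 (1991) §5 (5.1); J.-P. Serre, *Galois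
Cohomology* I.§2.4 (compatible pairs); [NeukirchANT1999] Ch. I §9 Prop. (9.1), (9.5)–(9.6); [SilvermanATAEC1994] II §2 Thm. 2.2(b).
-/

noncomputable section

open scoped Classical Pointwise

set_option linter.dupNamespace false
set_option autoImplicit false

namespace Summit.BirchSwinnertonDyer.BirchSwinnertonDyer.Theorems.PrintCf2.CMPrimes

open WeierstrassCurve Literature.NumberTheory.EllipticCurves Literature.NumberTheory.GaloisRepresentations Field NumberField
  IsDedekindDomain

/-! ## §1 The anti-commuting transport lift `τ = e σ₀ e⁻¹` -/

section Lift

variable (W : WeierstrassCurve ℚ) [W.IsElliptic] (K : Type) [Field K] [NumberField K]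

/-- **An anti-commuting transport lift.** `W/ℚ` elliptic, `K/ℚ` normal, `π ∈ End_K(E_K)` with `π² = π − 2`: for some `σ₀ ∈ Γ_ℚ` the
transport `τ = e σ₀ e⁻¹` to `K̄` (the tree's `absGaloisTransportRat K σ₀`, a lift of `τ|_K ∈ Aut(K/ℚ)`) ANTI-commutes with `π` on
`E(K̄)`: `π(τQ) = τQ − τ(πQ)` (`τ π τ⁻¹ = 1 − π = π̄`). From -w8's `exists_ratConj_of_cmIsogeny` on the isogeny realising `π`
(`exists_isogeny_apply_eq_cmEndo`). [cite: SilvermanATAEC1994, II §2 Thm. 2.2(b)] [cite: GrossLMS1991, §5 (5.1)] -/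
theorem exists_transport_anticommute [Normal ℚ K] (π : (W.baseChange K).endRing)
    (hrel : (π : AddMonoid.End (W.baseChange K).geomPoints) * π = π - 2) :
    ∃ (σ₀ : absoluteGaloisGroup ℚ)
      (hτ : IsLiftOfAut ((absGaloisTransportRat K σ₀).restrictNormal K) (absGaloisTransportRat K σ₀).toRingEquiv),
      ∀ Q, (π : AddMonoid.End (W.baseChange K).geomPoints) (hτ.pointsMap W Q) =
        hτ.pointsMap W Q - hτ.pointsMap W ((π : AddMonoid.End (W.baseChange K).geomPoints) Q) := by
  have hπ : (π : AddMonoid.End (W.baseChange K).geomPoints) ∈ (W.baseChange K).geomEndRing := (Subring.mem_inf.1 π.2).1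
  have hπG := ((W.baseChange K).mem_equivariantSubring_iff (π : AddMonoid.End (W.baseChange K).geomPoints)).1
    (Subring.mem_inf.1 π.2).2
  obtain ⟨φ, hφ, hrel'⟩ := exists_isogeny_apply_eq_cmEndo (W.baseChange K) hπ hπG hrel
  obtain ⟨σ₀, hσ₀⟩ := exists_ratConj_of_cmIsogeny W K φ hrel'
  set ι := Literature.NumberTheory.EllipticCurves.absClosureEquiv ℚ K with hι
  set e := W.geomPointsExtend K ι with he
  have hτ : IsLiftOfAut ((absGaloisTransportRat K σ₀).restrictNormal K) (absGaloisTransportRat K σ₀).toRingEquiv :=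
    fun x ↦ absGaloisTransportRat_algebraMap σ₀ x
  have hcoord : ∀ z : AlgebraicClosure ℚ, absGaloisTransportRat K σ₀ (ι z) = ι (σ₀ • z) := fun z ↦ by
    rw [hι]
    change absGaloisTransport (K := ℚ) (L := K) σ₀ (Literature.NumberTheory.EllipticCurves.absClosureEquiv ℚ K z) = _
    rw [absGaloisTransport_apply, AlgEquiv.symm_apply_apply]
  have hτe : ∀ P : W.geomPoints, hτ.pointsMap W (e P) = e (σ₀ • P) := by
    intro P
    change (W.baseChange (AlgebraicClosure ℚ)).toAffine.Point at P
    rcases P with _ | ⟨x, y, h⟩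
    · rfl
    · change Affine.Point.map (W' := W) hτ.algEquiv.toAlgHom (Affine.Point.map (W' := W) ι.toAlgHom (.some x y h)) =
        Affine.Point.map (W' := W) ι.toAlgHom
          (Affine.Point.map (W' := W) (absoluteGaloisGroup.toAlgEquiv ℚ σ₀).toAlgHom (.some x y h))
      rw [Affine.Point.map_some, Affine.Point.map_some, Affine.Point.map_some, Affine.Point.map_some]
      exact Affine.Point.some_eq_some_of_eq (hcoord x) (hcoord y)
  refine ⟨σ₀, hτ, fun Q ↦ ?_⟩
  obtain ⟨P, rfl⟩ := e.surjective Q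
  have hP' : φ (e (σ₀ • P)) = e (σ₀ • P) - e (σ₀ • e.symm (φ (e P))) := by
    have := congrArg e (hσ₀ P)
    rw [e.apply_symm_apply, map_sub] at this
    exact this
  rw [hτe, ← hφ, hP', ← hτe, ← hτe, e.apply_symm_apply, hφ]

variable {σ : K ≃ₐ[ℚ] K} {τ : AlgebraicClosure K ≃+* AlgebraicClosure K}

omit [W.IsElliptic] in
/-- `τ (τ⁻¹ Q) = Q` on `E(K̄)`. [folklore] -/
theorem pointsMap_pointsMap_symm (hτ : IsLiftOfAut σ τ) (Q : (W.baseChange K).geomPoints) :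
    hτ.pointsMap W (hτ.symm_isLiftOfAut.pointsMap W Q) = Q := by
  change ((W.baseChange K).baseChange (AlgebraicClosure K)).toAffine.Point at Q
  rcases Q with _ | ⟨x, y, hxy⟩
  · rfl
  · exact Affine.Point.some_eq_some_of_eq (τ.apply_symm_apply x) (τ.apply_symm_apply y)

omit [W.IsElliptic] in
/-- `τ⁻¹ (τ Q) = Q` on `E(K̄)`. [folklore] -/
theorem pointsMap_symm_pointsMap (hτ : IsLiftOfAut σ τ) (Q : (W.baseChange K).geomPoints) :
    hτ.symm_isLiftOfAut.pointsMap W (hτ.pointsMap W Q) = Q := by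
  change ((W.baseChange K).baseChange (AlgebraicClosure K)).toAffine.Point at Q
  rcases Q with _ | ⟨x, y, hxy⟩
  · rfl
  · exact Affine.Point.some_eq_some_of_eq (τ.symm_apply_apply x) (τ.symm_apply_apply y)

omit [W.IsElliptic] in
/-- Anti-commutation passes to the inverse lift: `π(τ⁻¹Q) = τ⁻¹Q − τ⁻¹(πQ)`. [folklore] -/
theorem pointsMap_symm_anticommute (hτ : IsLiftOfAut σ τ) {π : AddMonoid.End (W.baseChange K).geomPoints}
    (h : ∀ Q, π (hτ.pointsMap W Q) = hτ.pointsMap W Q - hτ.pointsMap W (π Q)) (Q : (W.baseChange K).geomPoints) :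
    π (hτ.symm_isLiftOfAut.pointsMap W Q) =
      hτ.symm_isLiftOfAut.pointsMap W Q - hτ.symm_isLiftOfAut.pointsMap W (π Q) := by
  have h1 := h (hτ.symm_isLiftOfAut.pointsMap W Q)
  rw [pointsMap_pointsMap_symm] at h1
  -- `h1 : π Q = Q - τ (π (τ⁻¹ Q))`
  have h2 : hτ.pointsMap W (π (hτ.symm_isLiftOfAut.pointsMap W Q)) = Q - π Q := by
    rw [h1, sub_sub_cancel]
  have h3 := congrArg (hτ.symm_isLiftOfAut.pointsMap W) h2
  rw [pointsMap_symm_pointsMap, map_sub] at h3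
  exact h3

end Lift

/-! ## §2 Conjugation by a transport lift moves inertia groups above `2` to inertia groups above `2` -/

section Inertia

variable {K : Type} [Field K] [NumberField K]

/-- **`τ⁻¹ I_𝔔 τ ⊆ I_{𝔔'}` with `𝔔' = τ⁻¹𝔔` again above `2`.** For the transport `τ = e h e⁻¹` of `h ∈ Γ_ℚ` (a lift of some
`σ' ∈ Aut(K/ℚ)`), a prime `𝔔` of `\bar ℤ_K` containing `2` and `σ ∈ I_𝔔`: the conjugate `τ⁻¹στ` (`IsLiftOfAut.conjGalCMH`) lies in
the inertia group of the prime `𝔔' = T⁻¹𝔔 ∋ 2`, `T y = ι(h • ι⁻¹ y)` the transport on `\bar ℤ_K` — on `\bar ℤ_K`,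
`τ⁻¹στ(y) − y = T⁻¹(σ(Ty) − Ty)` (the tree's `InertiaLift` bookkeeping, there for `h` stabilising `𝔔`). [folklore]
[cite: NeukirchANT1999, Ch. I §9, (9.5)–(9.6)] -/
theorem exists_conjGalCMH_mem_inertia_of_transport {h : absoluteGaloisGroup ℚ} {σ' : K ≃ₐ[ℚ] K}
    (ht : IsLiftOfAut σ' (absGaloisTransport (K := ℚ) (L := K) h).toRingEquiv)
    {𝔔 : Ideal (absIntegers (𝓞 K) K)} (h𝔔 : 𝔔.IsPrime) (h2 : ((2 : ℕ) : absIntegers (𝓞 K) K) ∈ 𝔔)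
    {σ : absoluteGaloisGroup K} (hσ : σ ∈ 𝔔.inertia (absoluteGaloisGroup K)) :
    ∃ 𝔔' : Ideal (absIntegers (𝓞 K) K), 𝔔'.IsPrime ∧ ((2 : ℕ) : absIntegers (𝓞 K) K) ∈ 𝔔' ∧
      ht.conjGalCMH σ ∈ 𝔔'.inertia (absoluteGaloisGroup K) := by
  let T : absIntegers (𝓞 K) K →+* absIntegers (𝓞 K) K :=
    (absIntegersMap ℚ K).comp ((MulSemiringAction.toRingHom (absoluteGaloisGroup ℚ) (absIntegers (𝓞 ℚ) ℚ) h).comp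
      (absIntegersEquiv ℚ K).symm.toRingHom)
  have hT : ∀ y, T y = absIntegersMap ℚ K (h • (absIntegersEquiv ℚ K).symm y) := fun _ ↦ rfl
  refine ⟨𝔔.comap T, Ideal.IsPrime.comap T, ?_, ?_⟩
  · rw [Ideal.mem_comap, map_natCast]
    exact h2
  · rw [AddSubgroup.mem_inertia]
    intro y
    set Ty := absIntegersMap ℚ K (h • (absIntegersEquiv ℚ K).symm y) with hTy
    have hval : ht.conjGalCMH σ • y =
        absIntegersMap ℚ K (h⁻¹ • (absIntegersEquiv ℚ K).symm (σ • Ty)) := by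
      apply Subtype.ext
      rw [integralClosure.coe_smul, InertiaLift.coe_transportIntegers, integralClosure.coe_smul, hTy,
        InertiaLift.coe_transportIntegers, map_inv]
      change (absGaloisTransport (K := ℚ) (L := K) h).toRingEquiv.symm
          ((show AlgebraicClosure K ≃ₐ[K] AlgebraicClosure K from σ)
            ((absGaloisTransport (K := ℚ) (L := K) h).toRingEquiv (y : AlgebraicClosure K))) = _
      rfl
    have hy : ht.conjGalCMH σ • y - y =
        absIntegersMap ℚ K (h⁻¹ • (absIntegersEquiv ℚ K).symm (σ • Ty - Ty)) := by
      rw [InertiaLift.transportIntegers_sub, hTy, InertiaLift.transportIntegers_inv_apply, hval]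
    rw [hy, Submodule.mem_toAddSubgroup, Ideal.mem_comap, hT]
    have hinv := InertiaLift.transportIntegers_inv_apply (K := K) h⁻¹ (σ • Ty - Ty)
    rw [inv_inv] at hinv
    rw [hinv]
    exact (AddSubgroup.mem_inertia.mp hσ) Ty

end Inertia

/-! ## §3 The pointwise `±1`-clause: conjugation invariance, all primes above `2`, transport along the lift -/

section Clause

variable (W : WeierstrassCurve ℚ) [W.IsElliptic] (K : Type) [Field K] [NumberField K]

omit [W.IsElliptic] in
/-- The pointwise clause «`g₀` acts on `M` as `±1`» for a `Γ_K`-stable `M ≤ E_K[2^∞]` is invariant under conjugation `g₀ ↦ s g₀ s⁻¹`.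
[folklore] -/
theorem smul_eq_or_neg_of_conj (π : (W.baseChange K).endRing) (ρ : ℤ_[2]) {g₀ : absoluteGaloisGroup K} (s : absoluteGaloisGroup K)
    (h : ∀ x ∈ (W.baseChange K).endEigenPrimaryTorsion 2 π ρ, g₀ • x = x ∨ g₀ • x = -x) :
    ∀ x ∈ (W.baseChange K).endEigenPrimaryTorsion 2 π ρ, (s * g₀ * s⁻¹) • x = x ∨ (s * g₀ * s⁻¹) • x = -x := by
  intro x hx
  have hx' := smul_mem_endEigenPrimaryTorsion π ρ s⁻¹ hx
  rcases h _ hx' with h1 | h1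
  · left
    rw [mul_smul, mul_smul, h1, smul_inv_smul]
  · right
    rw [mul_smul, mul_smul, h1, smul_neg, smul_inv_smul]

omit [W.IsElliptic] in
/-- **From the places to all primes of `\bar ℤ_K` above `2`.** If `GreenbergSelmer.inertia w` acts on `M = E[𝔮_ρ^∞]` pointwise as `±1`
for EVERY place `w ∋ 2` of `K`, then so does the inertia group `I_𝔔 ≤ Γ_K` of EVERY prime `𝔔 ∋ 2` of `\bar ℤ_K`: `𝔔` lies over the place
`w = 𝔔 ∩ 𝓞_K ∋ 2`, `𝔔 = s • 𝔓₀(w)` for some `s ∈ Γ_K` (transitivity, `exists_smul_eq_of_mem_primesAbove_holds`), `I_𝔔 = s I_{𝔓₀(w)} s⁻¹`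
(`Ideal.inertia_smul`) and `I_{𝔓₀(w)} = GreenbergSelmer.inertia w` (`inertia_adicCompletionPrime_eq_map_absInertia`).
[cite: NeukirchANT1999, Ch. I §9 Prop. (9.1) and (9.6)] -/
theorem forall_prime_inertia_smul_eq_or_neg (π : (W.baseChange K).endRing) (ρ : ℤ_[2])
    (h : ∀ w : HeightOneSpectrum (𝓞 K), ((2 : ℕ) : 𝓞 K) ∈ w.asIdeal →
      ∀ τ ∈ GreenbergSelmer.inertia w, ∀ x ∈ (W.baseChange K).endEigenPrimaryTorsion 2 π ρ, τ • x = x ∨ τ • x = -x) :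
    ∀ 𝔔 : Ideal (absIntegers (𝓞 K) K), 𝔔.IsPrime → ((2 : ℕ) : absIntegers (𝓞 K) K) ∈ 𝔔 →
      ∀ g ∈ 𝔔.inertia (absoluteGaloisGroup K),
        ∀ x ∈ (W.baseChange K).endEigenPrimaryTorsion 2 π ρ, g • x = x ∨ g • x = -x := by
  intro 𝔔 h𝔔 h2 g hg
  -- the place `w` under `𝔔`
  haveI := h𝔔
  have hne : 𝔔.under (𝓞 K) ≠ ⊥ := by
    intro h0
    have h2' : ((2 : ℕ) : 𝓞 K) ∈ 𝔔.under (𝓞 K) := by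
      rw [Ideal.under_def, Ideal.mem_comap, map_natCast]
      exact h2
    rw [h0, Ideal.mem_bot] at h2'
    exact two_ne_zero (Nat.cast_eq_zero.mp h2')
  let w : HeightOneSpectrum (𝓞 K) := ⟨𝔔.under (𝓞 K), inferInstance, hne⟩
  have hw2 : ((2 : ℕ) : 𝓞 K) ∈ w.asIdeal := by
    change ((2 : ℕ) : 𝓞 K) ∈ 𝔔.under (𝓞 K)
    rw [Ideal.under_def, Ideal.mem_comap, map_natCast]
    exact h2
  have h𝔔w : 𝔔 ∈ w.primesAbove := ⟨h𝔔, ⟨rfl⟩⟩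
  -- `𝔔 = s • 𝔓₀(w)`
  obtain ⟨s, hs⟩ := HeightOneSpectrum.exists_smul_eq_of_mem_primesAbove_holds (adicCompletionPrime_mem_primesAbove K w) h𝔔w
  -- `g = s g₀ s⁻¹` with `g₀ ∈ I_{𝔓₀(w)} = GreenbergSelmer.inertia w`
  rw [← hs, Ideal.inertia_smul, Subgroup.mem_pointwise_smul_iff_inv_smul_mem, MulAut.smul_def,
    MulAut.conj_inv_apply, inertia_adicCompletionPrime_eq_map_absInertia K w] at hg
  have hg₀ : s⁻¹ * g * s ∈ GreenbergSelmer.inertia w := hg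
  have key := smul_eq_or_neg_of_conj W K π ρ s (h w hw2 _ hg₀)
  rwa [show s * (s⁻¹ * g * s) * s⁻¹ = g by group] at key

/-- In a quadratic field with `2 = v v̄` split, every place above `2` is `v` or `v̄`. [cite: NeukirchANT1999, Ch. I §8 Prop. (8.2)] -/
theorem eq_or_eq_of_two_mem (hK2 : Module.finrank ℚ K = 2) {v vbar : HeightOneSpectrum (𝓞 K)}
    (hv : ((2 : ℕ) : 𝓞 K) ∈ v.asIdeal) (hvbar : ((2 : ℕ) : 𝓞 K) ∈ vbar.asIdeal) (hne : vbar ≠ v)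
    {w : HeightOneSpectrum (𝓞 K)} (hw : ((2 : ℕ) : 𝓞 K) ∈ w.asIdeal) : w = v ∨ w = vbar := by
  haveI : Fact (Nat.Prime 2) := ⟨Nat.prime_two⟩
  have hv' : v.under (𝓞 ℚ) = Summit.BirchSwinnertonDyer.Rank1Residual.X11b.ratPlace 2 :=
    Summit.BirchSwinnertonDyer.Rank1Residual.X11b.under_eq_ratPlace_of_mem hv
  have hvbar' : vbar.under (𝓞 ℚ) = Summit.BirchSwinnertonDyer.Rank1Residual.X11b.ratPlace 2 :=
    Summit.BirchSwinnertonDyer.Rank1Residual.X11b.under_eq_ratPlace_of_mem hvbar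
  have hw' : w.under (𝓞 ℚ) = Summit.BirchSwinnertonDyer.Rank1Residual.X11b.ratPlace 2 :=
    Summit.BirchSwinnertonDyer.Rank1Residual.X11b.under_eq_ratPlace_of_mem hw
  rcases placesOver_trichotomy_of_finrank_eq_two K hK2 (Summit.BirchSwinnertonDyer.Rank1Residual.X11b.ratPlace 2) with
    ⟨w₁, w₂, -, hset, -⟩ | ⟨u, hset, -, -⟩ | ⟨u, hset, -, -⟩
  · have h1 : v ∈ ({w₁, w₂} : Set (HeightOneSpectrum (𝓞 K))) := hset ▸ hv'
    have h2 : vbar ∈ ({w₁, w₂} : Set (HeightOneSpectrum (𝓞 K))) := hset ▸ hvbar'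
    have h3 : w ∈ ({w₁, w₂} : Set (HeightOneSpectrum (𝓞 K))) := hset ▸ hw'
    simp only [Set.mem_insert_iff, Set.mem_singleton_iff] at h1 h2 h3
    rcases h1 with rfl | rfl <;> rcases h2 with rfl | rfl <;> rcases h3 with rfl | rfl <;>
      first | exact absurd rfl hne | exact Or.inl rfl | exact Or.inr rfl
  · have h1 : v ∈ ({u} : Set (HeightOneSpectrum (𝓞 K))) := hset ▸ hv'
    have h2 : vbar ∈ ({u} : Set (HeightOneSpectrum (𝓞 K))) := hset ▸ hvbar'
    exact absurd ((Set.mem_singleton_iff.mp h2).trans (Set.mem_singleton_iff.mp h1).symm) hne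
  · have h1 : v ∈ ({u} : Set (HeightOneSpectrum (𝓞 K))) := hset ▸ hv'
    have h2 : vbar ∈ ({u} : Set (HeightOneSpectrum (𝓞 K))) := hset ▸ hvbar'
    exact absurd ((Set.mem_singleton_iff.mp h2).trans (Set.mem_singleton_iff.mp h1).symm) hne

variable {σ : K ≃ₐ[ℚ] K} {τ : AlgebraicClosure K ≃+* AlgebraicClosure K}

omit [W.IsElliptic] in
/-- **An anti-commuting additive bijection of `E(K̄)` maps `E[𝔮_ρ^∞]` into `E[𝔮_{1−ρ}^∞]`** (membership transfer): if `S ∘ P = id`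
and `π(PQ) = PQ − P(πQ)`, then for `x ∈ E[𝔮_ρ^∞]` the point `Px` (again `2`-primary) lies in the `(1 − ρ)`-summand.
[cite: Rubin1999, §2 and Prop. 5.4] -/
theorem mem_endEigenPrimaryTorsion_one_sub_of_anticommute (π : (W.baseChange K).endRing)
    (P S : (W.baseChange K).geomPoints →+ (W.baseChange K).geomPoints) (hSP : ∀ Q, S (P Q) = Q)
    (hanti : ∀ Q, (π : AddMonoid.End (W.baseChange K).geomPoints) (P Q) =
      P Q - P ((π : AddMonoid.End (W.baseChange K).geomPoints) Q))
    {ρ : ℤ_[2]} {x : ↥((W.baseChange K).geomPrimaryTorsion 2)} (hx : x ∈ (W.baseChange K).endEigenPrimaryTorsion 2 π ρ)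
    (hPx : P x ∈ (W.baseChange K).geomPrimaryTorsion 2) :
    (⟨P x, hPx⟩ : ↥((W.baseChange K).geomPrimaryTorsion 2)) ∈ (W.baseChange K).endEigenPrimaryTorsion 2 π (1 - ρ) := by
  haveI : Fact (Nat.Prime 2) := ⟨Nat.prime_two⟩
  rw [mem_endEigenPrimaryTorsion_iff]
  intro k N hk hN
  have hk' : 2 ^ k • P (x : (W.baseChange K).geomPoints) = 0 := by
    have := congrArg Subtype.val hk
    rwa [AddSubmonoidClass.coe_nsmul, ZeroMemClass.coe_zero] at this
  have hxk : 2 ^ k • x = 0 := by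
    apply Subtype.ext
    rw [AddSubmonoidClass.coe_nsmul, ZeroMemClass.coe_zero, ← hSP (2 ^ k • (x : (W.baseChange K).geomPoints)), map_nsmul,
      hk', map_zero]
  have hN' : (((1 - N : ℤ) : ℤ_[2]) - ρ) ∈ (Ideal.span {(2 : ℤ_[2]) ^ k} : Ideal ℤ_[2]) := by
    have : ((1 - N : ℤ) : ℤ_[2]) - ρ = -(((N : ℤ_[2]) - (1 - ρ))) := by push_cast; ring
    rw [this]
    exact neg_mem hN
  have hπx := (mem_endEigenPrimaryTorsion_iff π ρ x).1 hx k (1 - N) hxk hN'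
  change (π : AddMonoid.End (W.baseChange K).geomPoints) (P x) = N • P (x : (W.baseChange K).geomPoints)
  rw [hanti, hπx, map_zsmul, sub_smul, one_smul, sub_sub_cancel]

omit [W.IsElliptic] in
/-- The image of a `2`-primary point under an additive bijection is `2`-primary. [folklore] -/
theorem map_mem_geomPrimaryTorsion (P : (W.baseChange K).geomPoints →+ (W.baseChange K).geomPoints)
    (x : ↥((W.baseChange K).geomPrimaryTorsion 2)) : P x ∈ (W.baseChange K).geomPrimaryTorsion 2 := by
  obtain ⟨n, hn⟩ := (AddCommGroup.mem_primaryComponent).mp x.2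
  exact (AddCommGroup.mem_primaryComponent).mpr ⟨n, by rw [← map_nsmul, hn, map_zero]⟩

omit [W.IsElliptic] in
/-- **TRANSPORT OF THE CLAUSE ALONG THE ANTI-COMMUTING LIFT.** If `τ = e h e⁻¹` anti-commutes with `π` and the inertia group of EVERY
prime `𝔔 ∋ 2` of `\bar ℤ_K` acts on `E[𝔮_ρ^∞]` pointwise as `±1`, then the same holds for `E[𝔮_{1−ρ}^∞]`: for `x = τy`
(`y = τ⁻¹x ∈ E[𝔮_ρ^∞]` by anti-commutation) and `g ∈ I_𝔔`, `g x = τ((τ⁻¹gτ) y) = τ(±y) = ±x`, since `τ⁻¹gτ ∈ I_{𝔔'}` with `𝔔' ∋ 2`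
(`exists_conjGalCMH_mem_inertia_of_transport`). [cite: GrossLMS1991, §5 (5.1)] [cite: Rubin1999, §3 Cor. 3.17] -/
theorem forall_prime_inertia_smul_eq_or_neg_of_transport (π : (W.baseChange K).endRing) (ρ : ℤ_[2])
    {h : absoluteGaloisGroup ℚ} {σ' : K ≃ₐ[ℚ] K} (ht : IsLiftOfAut σ' (absGaloisTransport (K := ℚ) (L := K) h).toRingEquiv)
    (hanti : ∀ Q, (π : AddMonoid.End (W.baseChange K).geomPoints) (ht.pointsMap W Q) =
      ht.pointsMap W Q - ht.pointsMap W ((π : AddMonoid.End (W.baseChange K).geomPoints) Q))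
    (hP : ∀ 𝔔 : Ideal (absIntegers (𝓞 K) K), 𝔔.IsPrime → ((2 : ℕ) : absIntegers (𝓞 K) K) ∈ 𝔔 →
      ∀ g ∈ 𝔔.inertia (absoluteGaloisGroup K),
        ∀ x ∈ (W.baseChange K).endEigenPrimaryTorsion 2 π ρ, g • x = x ∨ g • x = -x) :
    ∀ 𝔔 : Ideal (absIntegers (𝓞 K) K), 𝔔.IsPrime → ((2 : ℕ) : absIntegers (𝓞 K) K) ∈ 𝔔 →
      ∀ g ∈ 𝔔.inertia (absoluteGaloisGroup K),
        ∀ x ∈ (W.baseChange K).endEigenPrimaryTorsion 2 π (1 - ρ), g • x = x ∨ g • x = -x := by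
  intro 𝔔 h𝔔 h2 g hg x hx
  have hPS : ∀ Q, ht.pointsMap W (ht.symm_isLiftOfAut.pointsMap W Q) = Q := pointsMap_pointsMap_symm W K ht
  -- `y = τ⁻¹ x ∈ E[𝔮_ρ^∞]`
  have hSx : ht.symm_isLiftOfAut.pointsMap W x ∈ (W.baseChange K).geomPrimaryTorsion 2 :=
    map_mem_geomPrimaryTorsion W K _ x
  have hy : (⟨ht.symm_isLiftOfAut.pointsMap W x, hSx⟩ : ↥((W.baseChange K).geomPrimaryTorsion 2)) ∈
      (W.baseChange K).endEigenPrimaryTorsion 2 π ρ := by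
    have := mem_endEigenPrimaryTorsion_one_sub_of_anticommute W K π (ht.symm_isLiftOfAut.pointsMap W) (ht.pointsMap W) hPS
      (pointsMap_symm_anticommute W K ht hanti) hx hSx
    rwa [sub_sub_cancel] at this
  -- `τ⁻¹ g τ ∈ I_{𝔔'}`, `𝔔' ∋ 2`
  obtain ⟨𝔔', h𝔔', h2', hg'⟩ := exists_conjGalCMH_mem_inertia_of_transport ht h𝔔 h2 hg
  have hval : (((g • x : ↥((W.baseChange K).geomPrimaryTorsion 2))) : (W.baseChange K).geomPoints) =
      ht.pointsMap W (ht.conjGalCMH g • ht.symm_isLiftOfAut.pointsMap W (x : (W.baseChange K).geomPoints)) := by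
    rw [primaryComponent.coe_smul, IsLiftOfAut.pointsMap_smul, hPS]
  rcases hP 𝔔' h𝔔' h2' _ hg' _ hy with h1 | h1
  · left
    apply Subtype.ext
    have h1' := congrArg Subtype.val h1
    rw [primaryComponent.coe_smul] at h1'
    change ht.conjGalCMH g • ht.symm_isLiftOfAut.pointsMap W (x : (W.baseChange K).geomPoints) =
      ht.symm_isLiftOfAut.pointsMap W (x : (W.baseChange K).geomPoints) at h1'
    rw [hval, h1', hPS]
  · right
    apply Subtype.ext
    have h1' := congrArg Subtype.val h1
    rw [primaryComponent.coe_smul, AddSubgroup.coe_neg] at h1'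
    change ht.conjGalCMH g • ht.symm_isLiftOfAut.pointsMap W (x : (W.baseChange K).geomPoints) =
      -ht.symm_isLiftOfAut.pointsMap W (x : (W.baseChange K).geomPoints) at h1'
    rw [AddSubgroup.coe_neg, hval, h1', map_neg, hPS]

end Clause

end Summit.BirchSwinnertonDyer.BirchSwinnertonDyer.Theorems.PrintCf2.CMPrimes

end
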